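import Summits.HodgeConjecture.HodgeConjecture.Theorems.WeilTypeLadderLocalAnchorOnPath
import Summits.HodgeConjecture.HodgeConjecture.Theorems.WeilTypeLadderSimilarReach
import Literature.AlgebraicGeometry.HodgeTheory.WeilClassesBlochSeed
import HarnessLib

/-!
# WeilTypeLadder · DOOR S: the rungs from a BLOCH SEED (an integral Bloch-semiregular local complete intersection carrying
# `q·hⁿ + w` on one anchor) and Bloch's semiregularity theorem — the first engine door of the ladder whose
# deformation-theoretic input is REFEREED

b2b cell `hweil` (packet `run/shared/lean/b2b/hodge-weil/`, `LADDER.md ## P2g4`; notes `b2b-hweil-pv2-g4/BLOCH-SEEDS.md`).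
Prover 2, generation 4 (variational chair). The carver's three doors to the open rungs (`LADDER.md ## CARVER v4 C30`)
each end in ONE un-printed LOCAL input: door A `HasLocallyAlgebraicWeilAnchor n d` (one hyperbolic anchor; reach fact
`weilFamilyReach_hyperbolic`), door B′ `HasSimilarLocallyAlgebraicWeilAnchorsAwayFromSplit 3 d` (Weil-similar anchors;
reach fact `weilFamilyReach_similar`), door T (tensor anchors; Deligne's family through the target). So far the
object-level feeders of those inputs typed in the tree rest on UNREFEREED deformation theorems (Markman 2025's twisted
reflexive semiregularity, `Markman2025_secantAnchor_locallyAlgebraic_sixfold`; Perry 2026,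
`Perry2026_semiregular(Twisted)_remainsAlgebraic`). This file composes the doors with the feeder whose deformation
theory is REFEREED and rendered in the tree on real carriers — Bloch 1972 Thm. (7.4)/Remark (7.5) = Buchweitz–Flenner
2003 Thm. 5.2 at `I = {n}` = Voisin, LNM 1594, L7 Thm. 2.4, the named fact `BlochSemiregularSpread (2n) n`
(`Literature/…/BlochSemiregularSpread.lean`) — through the bridges of `Literature/…/WeilClassesBlochSeed.lean` (this
seat): `HasBlochSeedAt n P h w` (an INTEGRAL regular immersion `Z ↪ P` of codimension `n`, Bloch-semiregular, with
`q·hⁿ + w` supported on `Z`), `HasHyperbolicBlochSeed n d`, `HasSimilarBlochSeeds(AwayFromSplit) n d`.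

* `markman2025_hyperbolicSixfold_of_reach_of_blochSpread_of_seeds(_four_mul)` — **F0a** (the 2025 floor, BY NAME) ⟸
  reach ∧ `BlochSemiregularSpread 6 3` ∧ one hyperbolic Bloch seed per `d` (resp. per `4d`); with
  `floor_of_reach_of_blochSpread_of_seeds` also F1 (`floorFourfolds_of_floorSixfolds`, unconditional).
* `splitEightfolds_…`, **`weilSixfolds_of_reach_of_blochSpread_of_seeds_four`** — R2₈, hence **item
  stmt-HodgeConjecture-2524 (`WeilSixfolds`, ALL sixfolds, every `d`, every discriminant) ⟸ reach ∧
  `BlochSemiregularSpread 8 4` ∧ one hyperbolic Bloch seed in dimension 8 per `d`** (door A one dimension up, via the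
  unconditional degeneration edge R2₈ ⟹ R1 of `WeilTypeLadderDegenerationUp.lean`), and R1′.
* **`weilSixfolds_of_floor_of_reachSimilar_of_blochSpread_of_similarSeeds`** — stmt-2524 ⟸ F0a ∧ `weilFamilyReach_similar` ∧
  `BlochSemiregularSpread 6 3` ∧ a Bloch seed on a Weil-similar anchor of every NON-hyperbolic sixfold (door B′); with the
  all-targets and R1′ variants.
* `weilClassesImaginaryQuadratic_of_reach_of_blochSpread_of_seeds` — R∞ (Weil 1977, every imaginary quadratic `K`, every
  `2n ≥ 4`) ⟸ reach ∧ (`∀ n ≥ 3`, `BlochSemiregularSpread (2n) n`) ∧ hyperbolic seeds at `(3, 4d)` and `(n ≥ 4, d)`.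
* `blochSemiregularSpread_of_hodgeConjecture` — ON-PATH lemma of the refereed input: `HodgeConjecture →
  BlochSemiregularSpread n p` (it is the `(n, p)` slice of HC, `BlochSemiregularSpreadCells`). The SEED predicates carry
  NO on-path lemma: they are design inputs (Bloch (7.5): semiregular representatives in codimension `> 1` are "wide
  open"), not cases of HC.

HONEST LABEL. Nothing is asserted; no definition; sorry-free; every edge is `proof.conditional` on hypotheses BY NAME.
Score unchanged: 0 unconditional rungs above the floor. What the door buys: its transport half is refereed AND typed
(Bloch/BF/Voisin ∧ Deligne–van Geemen reach), so a rung through it would be conditional on NO preprint; its open half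
is ONE existence statement per `(n, d)` (resp. per similarity class) about ONE explicit variety — the same "(7.5)
problem" the crux seats isolated at tensor anchors (`Theorems/HeckePrymWeilHodgeWeilOfSemiregularCleanLci.lean`,
`hodgeWeil_of_semiregularCleanLci_of_globalAction`, route `HeckePrymWeil`, `p ≡ 3 (4)` prime; crux workfiles
`Cruxes/WeilSixfoldsSqrtMinus7/Lines/semiregular-clean-lci-six*.md`), here for the ladder's hyperbolic and
similarity doors and every `K = ℚ(√-d)`. DESIGN-SPACE CENSUS of the seed (what it may NOT be — single subtori,
galleries, disconnected unions, divisor complete intersections; what survives — integral lci that forget their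
constituents, e.g. degeneracy loci, whose only open property is semiregularity): module docstring of
`WeilClassesBlochSeed.lean` and `BLOCH-SEEDS.md`, with pointers to the crux seats' no-go theorems.
-/

-- every declaration of this problem lives in `Summit.HodgeConjecture.HodgeConjecture.…` (summit = sub-problem)
set_option linter.dupNamespace false

noncomputable section

open CategoryTheory AlgebraicGeometry

namespace Summit.HodgeConjecture.HodgeConjecture.WeilTypeLadder

open Literature.AlgebraicGeometry Literature.AlgebraicGeometry.Motives
open Literature.AlgebraicGeometry.HodgeTheory
open Literature.AlgebraicTopology.SingularHomology

/-! ## Door A (hyperbolic anchors) fed by Bloch seeds -/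

/-- **F0a ⟸ reach ∧ Bloch's theorem at `(6, 3)` ∧ one hyperbolic Bloch seed per `d`.** The floor fact
`Markman2025_weilClasses_algebraic_hyperbolicSixfold` (Markman 2025 Thm. 1.5.1, BY NAME) follows from the refereed reach
fact `weilFamilyReach_hyperbolic`, the refereed class-level Bloch theorem `BlochSemiregularSpread 6 3`, and, for every
`d ≥ 1`, ONE hyperbolic `√-d`-Weil sixfold carrying an integral Bloch-semiregular lci threefold with class `q·h_K³ + w`
(`HasHyperbolicBlochSeed 3 d`) — via `hasLocallyAlgebraicWeilAnchor_of_blochSpread_of_hyperbolicBlochSeed` and the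
landed door-A engine `markman2025_hyperbolicSixfold_of_reach_of_localAnchor`. A refereed-input certification path for
the 2025 floor, conditional on the seeds. [cite: Bloch1972Semiregularity, Thm. (7.4) and Remark (7.5)]
[cite: Deligne1982HodgeCycles, proof of Thm. 4.8] [cite: Markman2025SecantWeil, Thm. 1.5.1] -/
theorem markman2025_hyperbolicSixfold_of_reach_of_blochSpread_of_seeds (hF : weilFamilyReach_hyperbolic)
    (hB : BlochSemiregularSpread (2 * 3) 3) (hS : ∀ d : ℕ, 0 < d → HasHyperbolicBlochSeed 3 d) :
    Markman2025_weilClasses_algebraic_hyperbolicSixfold :=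
  markman2025_hyperbolicSixfold_of_reach_of_localAnchor hF fun d hd =>
    hasLocallyAlgebraicWeilAnchor_of_blochSpread_of_hyperbolicBlochSeed hB (hS d hd)

/-- **F0a ⟸ reach ∧ Bloch's theorem at `(6, 3)` ∧ hyperbolic Bloch seeds at the discriminants `4d` only** (the
`(A, φ, d) ↦ (A, 2φ, 4d)` transport of `WeilTypeLadderLocalAnchorFourMul.lean` is kernel-checked, so seeds are needed
only for `ψ₀² = -4d`). [cite: Bloch1972Semiregularity, Thm. (7.4) and Remark (7.5)] [cite: Markman2025SecantWeil, Thm. 1.5.1] -/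
theorem markman2025_hyperbolicSixfold_of_reach_of_blochSpread_of_seeds_four_mul (hF : weilFamilyReach_hyperbolic)
    (hB : BlochSemiregularSpread (2 * 3) 3) (hS : ∀ d : ℕ, 0 < d → HasHyperbolicBlochSeed 3 (4 * d)) :
    Markman2025_weilClasses_algebraic_hyperbolicSixfold :=
  markman2025_hyperbolicSixfold_of_reach_of_localAnchor_four_mul hF fun d hd =>
    hasLocallyAlgebraicWeilAnchor_of_blochSpread_of_hyperbolicBlochSeed hB (hS d hd)

/-- **The whole 2025 floor F0a ∧ F1 from reach ∧ Bloch at `(6, 3)` ∧ hyperbolic seeds in dimension 6** (F0a ⟹ F1 is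
the unconditional `floorFourfolds_of_floorSixfolds`). [cite: Bloch1972Semiregularity, Thm. (7.4) and Remark (7.5)]
[cite: Markman2025SecantWeil, Thm. 1.5.1 and §11] -/
theorem floor_of_reach_of_blochSpread_of_seeds (hF : weilFamilyReach_hyperbolic)
    (hB : BlochSemiregularSpread (2 * 3) 3) (hS : ∀ d : ℕ, 0 < d → HasHyperbolicBlochSeed 3 d) :
    Markman2025_weilClasses_algebraic_hyperbolicSixfold ∧ Markman2025_weilClasses_algebraic_abelianFourfold :=
  have h := markman2025_hyperbolicSixfold_of_reach_of_blochSpread_of_seeds hF hB hS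
  ⟨h, floorFourfolds_of_floorSixfolds h⟩

/-- **R2₈ (`SplitEightfolds`: every hyperbolic `√-d`-Weil eightfold, every `d`) ⟸ reach ∧ Bloch's theorem at
`(8, 4)` ∧ one hyperbolic Bloch seed in dimension 8 per `d`.** Door A one dimension up: Markman's secant toolbox has
no dimension-8 instance (Euler-form barrier, `SemiregularityEulerFormBarrier.lean`), Bloch's lci theorem has no such
numerical obstruction — its open content is the seed. [cite: Bloch1972Semiregularity, Thm. (7.4) and Remark (7.5)]
[cite: Deligne1982HodgeCycles, proof of Thm. 4.8] -/
theorem splitEightfolds_of_reach_of_blochSpread_of_seeds (hF : weilFamilyReach_hyperbolic)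
    (hB : BlochSemiregularSpread (2 * 4) 4) (hS : ∀ d : ℕ, 0 < d → HasHyperbolicBlochSeed 4 d) : SplitEightfolds :=
  splitEightfolds_of_reach_of_localAnchor hF fun d hd =>
    hasLocallyAlgebraicWeilAnchor_of_blochSpread_of_hyperbolicBlochSeed hB (hS d hd)

/-- **Item stmt-HodgeConjecture-2524 (`WeilSixfolds`: the Hodge–Weil classes of EVERY `√-d`-Weil abelian sixfold,
every `d`, every discriminant) ⟸ reach ∧ Bloch's theorem at `(8, 4)` ∧ one hyperbolic Bloch seed in dimension 8 per
`d`** — through R2₈ and the unconditional degeneration edge R2₈ ⟹ R1 (`weilSixfolds_of_splitEightfolds`, Schoen §10 /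
Markman §11.5 one dimension up). [cite: Bloch1972Semiregularity, Thm. (7.4) and Remark (7.5)]
[cite: Markman2025SecantWeil, §11.5] [cite: Schoen1998HodgeWeilAddendum, §10] -/
theorem weilSixfolds_of_reach_of_blochSpread_of_seeds_four (hF : weilFamilyReach_hyperbolic)
    (hB : BlochSemiregularSpread (2 * 4) 4) (hS : ∀ d : ℕ, 0 < d → HasHyperbolicBlochSeed 4 d) :
    Theses.SevenfoldWeilCensus.WeilSixfolds :=
  weilSixfolds_of_reach_of_localAnchor_four hF fun d hd =>
    hasLocallyAlgebraicWeilAnchor_of_blochSpread_of_hyperbolicBlochSeed hB (hS d hd)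

/-- **R1′ (`NonsplitSixfolds`) ⟸ reach ∧ Bloch at `(8, 4)` ∧ hyperbolic seeds in dimension 8.**
[cite: Bloch1972Semiregularity, Thm. (7.4) and Remark (7.5)] [cite: Markman2025SecantWeil, §11.5] -/
theorem nonsplitSixfolds_of_reach_of_blochSpread_of_seeds_four (hF : weilFamilyReach_hyperbolic)
    (hB : BlochSemiregularSpread (2 * 4) 4) (hS : ∀ d : ℕ, 0 < d → HasHyperbolicBlochSeed 4 d) : NonsplitSixfolds :=
  nonsplitSixfolds_of_reach_of_localAnchor_four hF fun d hd =>
    hasLocallyAlgebraicWeilAnchor_of_blochSpread_of_hyperbolicBlochSeed hB (hS d hd)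

/-! ## Door B′ (Weil-similar anchors) fed by Bloch seeds -/

/-- **Item stmt-HodgeConjecture-2524 (`WeilSixfolds`) ⟸ F0a ∧ `weilFamilyReach_similar` ∧ Bloch's theorem at `(6, 3)` ∧
a Bloch seed on a Weil-similar anchor of every NON-hyperbolic `√-d`-Weil sixfold** (door B′ of the carver: only the
non-split targets need anchors; the intended anchors are product points `X⁴ × S²` in the target's similarity class,
Schoen §10). [cite: Bloch1972Semiregularity, Thm. (7.4) and Remark (7.5)] [cite: Deligne1982HodgeCycles, proof of Thm. 4.8]
[cite: Schoen1998HodgeWeilAddendum, §10] -/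
theorem weilSixfolds_of_floor_of_reachSimilar_of_blochSpread_of_similarSeeds
    (hF0a : Markman2025_weilClasses_algebraic_hyperbolicSixfold) (hF : weilFamilyReach_similar)
    (hB : BlochSemiregularSpread (2 * 3) 3) (hS : ∀ d : ℕ, 0 < d → HasSimilarBlochSeedsAwayFromSplit 3 d) :
    Theses.SevenfoldWeilCensus.WeilSixfolds :=
  weilSixfolds_of_floor_of_reachSimilar_of_similarAnchorsAwayFromSplit hF0a hF fun d hd =>
    hasSimilarLocallyAlgebraicWeilAnchorsAwayFromSplit_of_blochSpread_of_similarBlochSeeds hB (hS d hd)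

/-- **R1′ (`NonsplitSixfolds`) ⟸ `weilFamilyReach_similar` ∧ Bloch at `(6, 3)` ∧ similar seeds for the non-hyperbolic
sixfolds** (no floor needed). [cite: Bloch1972Semiregularity, Thm. (7.4) and Remark (7.5)]
[cite: Deligne1982HodgeCycles, proof of Thm. 4.8] -/
theorem nonsplitSixfolds_of_reachSimilar_of_blochSpread_of_similarSeeds (hF : weilFamilyReach_similar)
    (hB : BlochSemiregularSpread (2 * 3) 3) (hS : ∀ d : ℕ, 0 < d → HasSimilarBlochSeedsAwayFromSplit 3 d) :
    NonsplitSixfolds :=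
  nonsplitSixfolds_of_reachSimilar_of_similarAnchorsAwayFromSplit hF fun d hd =>
    hasSimilarLocallyAlgebraicWeilAnchorsAwayFromSplit_of_blochSpread_of_similarBlochSeeds hB (hS d hd)

/-- **stmt-2524 (`WeilSixfolds`) ⟸ `weilFamilyReach_similar` ∧ Bloch at `(6, 3)` ∧ similar seeds for ALL sixfolds**
(floor-free variant). [cite: Bloch1972Semiregularity, Thm. (7.4) and Remark (7.5)] [cite: Deligne1982HodgeCycles, proof of Thm. 4.8] -/
theorem weilSixfolds_of_reachSimilar_of_blochSpread_of_similarSeeds (hF : weilFamilyReach_similar)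
    (hB : BlochSemiregularSpread (2 * 3) 3) (hS : ∀ d : ℕ, 0 < d → HasSimilarBlochSeeds 3 d) :
    Theses.SevenfoldWeilCensus.WeilSixfolds :=
  weilSixfolds_of_reachSimilar_of_similarAnchors hF fun d hd =>
    hasSimilarLocallyAlgebraicWeilAnchors_of_blochSpread_of_similarBlochSeeds hB (hS d hd)

/-! ## R∞ (Weil 1977 for imaginary quadratic fields) fed by Bloch seeds -/

/-- **R∞ (`WeilClassesImaginaryQuadratic`: every imaginary quadratic `K`, every `2n ≥ 4`, every discriminant) ⟸ reach
∧ Bloch's theorem at every `(2n, n)`, `n ≥ 3` ∧ hyperbolic Bloch seeds at `(3, 4d)` and at every `(n ≥ 4, d)`** —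
through `weilClassesImaginaryQuadratic_of_reach_of_localAnchors` (R∞ ⟺ F0a ∧ R2).
[cite: Bloch1972Semiregularity, Thm. (7.4) and Remark (7.5)] [cite: Weil1977HodgeRing, §3]
[cite: Deligne1982HodgeCycles, proof of Thm. 4.8] -/
theorem weilClassesImaginaryQuadratic_of_reach_of_blochSpread_of_seeds (hF : weilFamilyReach_hyperbolic)
    (hB : ∀ n : ℕ, 3 ≤ n → BlochSemiregularSpread (2 * n) n)
    (h3 : ∀ d : ℕ, 0 < d → HasHyperbolicBlochSeed 3 (4 * d))
    (h4 : ∀ n : ℕ, 4 ≤ n → ∀ d : ℕ, 0 < d → HasHyperbolicBlochSeed n d) : WeilClassesImaginaryQuadratic :=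
  weilClassesImaginaryQuadratic_of_reach_of_localAnchors hF
    (fun d hd => hasLocallyAlgebraicWeilAnchor_of_blochSpread_of_hyperbolicBlochSeed (hB 3 le_rfl) (h3 d hd))
    (fun n hn d hd => hasLocallyAlgebraicWeilAnchor_of_blochSpread_of_hyperbolicBlochSeed (hB n (by omega)) (h4 n hn d hd))

/-! ## On-path lemma of the refereed input -/

/-- **`HodgeConjecture → BlochSemiregularSpread n p`** (forward contract for the FACT hypothesis of door S): the
class-level Bloch theorem in relative dimension `n`, codimension `p`, is the `(n, p)` slice of the Hodge conjecture
(`blochSemiregularSpread_of_forall_mem_algebraicClasses`), so under HC it holds with `U = S(ℂ)`. The SEED predicates of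
the door are design inputs and deliberately carry no such lemma. [cite: Deligne2000, §1]
[cite: Bloch1972Semiregularity, Thm. (7.4)] -/
theorem blochSemiregularSpread_of_hodgeConjecture (hHC : _root_.HodgeConjecture) (n p : ℕ) :
    BlochSemiregularSpread n p :=
  blochSemiregularSpread_of_forall_mem_algebraicClasses fun _ hX c hc hH => (hHC hX).2 p c hc hH

end Summit.HodgeConjecture.HodgeConjecture.WeilTypeLadder

end
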